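import Mathlib
import Literature.MathematicalPhysics.QuantumFieldTheory.Balaban1983to89.MatrixNorms
import Summits.QuantumFields.BalabanUV.T4Continuum.Support.AveragingDeficitHSInner
import Summits.QuantumFields.BalabanUV.T4Continuum.Support.NE3CovariantFaceTrace
import Summits.QuantumFields.BalabanUV.T4Continuum.Support.NE3LandauOrbit

/-!
# NE3, route H♮ row K5-inv: the near-scalar solve (ruling ρ-g23-5)

Finite-dimensional linear algebra used by the S7 competitor of the curved slice Poincaré inequality
(junction J-ne3leaf02g6-1, ruling ρ-g23-5): the competitor must reproduce the NESTED transported block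
means `bmeanIterW L k W ζ′` exactly, and the dressed-bump coefficient doing so solves, block by block, a
linear equation `t • c + K c = δ` on `𝔤 = Matrix n n ℂ` whose linear part `K` (nested-minus-single-scale
mean of the dressed bump) is small: `ν (K c) ≤ κ · ν c` with `κ < t` (`t = tentMean`, `κ = E_k` of J2).

For an abstract gauge `ν` (hypotheses `hs` absolute homogeneity, `ha` subadditivity, `hd` definiteness —
the instance norm, or the normalised Hilbert–Schmidt norm `nhsNorm`) on a finite-dimensional real vector
space we prove: `t • id + K` is injective (`(t − κ) ν c ≤ 0`), hence bijective
(`LinearMap.injective_iff_surjective`), and every solution obeys `ν c ≤ ν δ / (t − κ)`; `nearScalarInv`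
(generic) / `nhsNearScalarInv` (matrices, `nhsNorm`) is the inverse as an ℝ-linear map, with `…_eq`
(solves), `…_apply` (left inverse), `…_map_comm` (equivariance under maps commuting with `K`: skewness
downstream), `…_congr` (congruence in `K`: periodicity downstream) and the bound (`norm_nearScalarInv_le`,
`nhsNorm_nhsNearScalarInv_le`, `nhsNormSq_nhsNearScalarInv_le`).

Honest status: linear algebra only; (P♮)_W, NE3, the T⁴ spine are NOT proved here.
-/

namespace Summit.QuantumFields.BalabanUV.T4Continuum.NE3NearScalarSolve

open scoped BigOperators Matrix.Norms.L2Operator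

open Literature.MathematicalPhysics.QuantumFieldTheory.Balaban1983to89
open MatrixNorms

section Gauge

variable {E : Type*} [AddCommGroup E] [Module ℝ E] {ν : E → ℝ}

/-- An absolutely homogeneous gauge vanishes at zero. -/
theorem gauge_zero (hs : ∀ (r : ℝ) (c : E), ν (r • c) = |r| * ν c) : ν 0 = 0 := by
  have h := hs 0 (0 : E)
  simp only [zero_smul, abs_zero, zero_mul] at h
  exact h

/-- An absolutely homogeneous gauge is even. -/
theorem gauge_neg (hs : ∀ (r : ℝ) (c : E), ν (r • c) = |r| * ν c) (c : E) : ν (-c) = ν c := by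
  have h := hs (-1) c
  simp only [neg_smul, one_smul, abs_neg, abs_one, one_mul] at h
  exact h

/-- An absolutely homogeneous subadditive gauge is nonnegative. -/
theorem gauge_nonneg (hs : ∀ (r : ℝ) (c : E), ν (r • c) = |r| * ν c) (ha : ∀ a b : E, ν (a + b) ≤ ν a + ν b)
    (c : E) : 0 ≤ ν c := by
  have h := ha c (-c)
  rw [add_neg_cancel, gauge_zero hs, gauge_neg hs] at h
  linarith

/-- The a-priori bound: a solution of `t • c + K c = δ` with `ν (K c) ≤ κ ν c`, `κ < t`, obeys
`ν c ≤ ν δ / (t - κ)`. -/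
theorem gauge_le_of_eq (hs : ∀ (r : ℝ) (c : E), ν (r • c) = |r| * ν c) (ha : ∀ a b : E, ν (a + b) ≤ ν a + ν b)
    (K : E →ₗ[ℝ] E) {t κ : ℝ} (ht : 0 ≤ t) (hκt : κ < t) (hK : ∀ c, ν (K c) ≤ κ * ν c) {c δ : E}
    (h : t • c + K c = δ) : ν c ≤ ν δ / (t - κ) := by
  rw [le_div_iff₀ (sub_pos.2 hκt)]
  have h1 : t • c = δ + -(K c) := by rw [← h]; abel
  have h2 : ν (t • c) ≤ ν δ + ν (K c) := by
    rw [h1]; exact (ha _ _).trans (by rw [gauge_neg hs])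
  rw [hs, abs_of_nonneg ht] at h2
  have h3 := hK c
  nlinarith

/-- Injectivity of `t • id + K` for a `ν`-small `K`. -/
theorem gauge_injective (hs : ∀ (r : ℝ) (c : E), ν (r • c) = |r| * ν c) (ha : ∀ a b : E, ν (a + b) ≤ ν a + ν b)
    (hd : ∀ c : E, ν c = 0 → c = 0) (K : E →ₗ[ℝ] E) {t κ : ℝ} (ht : 0 ≤ t) (hκt : κ < t)
    (hK : ∀ c, ν (K c) ≤ κ * ν c) : Function.Injective (t • LinearMap.id + K : E →ₗ[ℝ] E) := by
  rw [← LinearMap.ker_eq_bot, LinearMap.ker_eq_bot']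
  intro c hc
  have hc' : t • c + K c = 0 := by simpa using hc
  have h := gauge_le_of_eq hs ha K ht hκt hK hc'
  rw [gauge_zero hs, zero_div] at h
  exact hd c (le_antisymm h (gauge_nonneg hs ha c))

/-- Bijectivity of `t • id + K` in finite dimension. -/
theorem gauge_bijective [FiniteDimensional ℝ E] (hs : ∀ (r : ℝ) (c : E), ν (r • c) = |r| * ν c)
    (ha : ∀ a b : E, ν (a + b) ≤ ν a + ν b) (hd : ∀ c : E, ν c = 0 → c = 0) (K : E →ₗ[ℝ] E) {t κ : ℝ}
    (ht : 0 ≤ t) (hκt : κ < t) (hK : ∀ c, ν (K c) ≤ κ * ν c) :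
    Function.Bijective (t • LinearMap.id + K : E →ₗ[ℝ] E) :=
  ⟨gauge_injective hs ha hd K ht hκt hK,
    LinearMap.injective_iff_surjective.1 (gauge_injective hs ha hd K ht hκt hK)⟩

/-- Existence, uniqueness and the bound, gauge form. -/
theorem gauge_existsUnique_solve [FiniteDimensional ℝ E] (hs : ∀ (r : ℝ) (c : E), ν (r • c) = |r| * ν c)
    (ha : ∀ a b : E, ν (a + b) ≤ ν a + ν b) (hd : ∀ c : E, ν c = 0 → c = 0) (K : E →ₗ[ℝ] E) {t κ : ℝ}
    (ht : 0 ≤ t) (hκt : κ < t) (hK : ∀ c, ν (K c) ≤ κ * ν c) (δ : E) :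
    ∃! c : E, t • c + K c = δ ∧ ν c ≤ ν δ / (t - κ) := by
  obtain ⟨c, hc⟩ := (gauge_bijective hs ha hd K ht hκt hK).2 δ
  have hc' : t • c + K c = δ := by simpa using hc
  refine ⟨c, ⟨hc', gauge_le_of_eq hs ha K ht hκt hK hc'⟩, fun c' hc'' => ?_⟩
  apply gauge_injective hs ha hd K ht hκt hK
  simp only [LinearMap.add_apply, LinearMap.smul_apply, LinearMap.id_apply]
  rw [hc''.1, hc']

end Gauge

section Inverse

variable {E : Type*} [AddCommGroup E] [Module ℝ E] [FiniteDimensional ℝ E] {ν : E → ℝ}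

/-- DATA: the inverse of `t • id + K` (for a `ν`-small `K`), as a linear map. -/
noncomputable def nearScalarInv (hs : ∀ (r : ℝ) (c : E), ν (r • c) = |r| * ν c)
    (ha : ∀ a b : E, ν (a + b) ≤ ν a + ν b) (hd : ∀ c : E, ν c = 0 → c = 0) (K : E →ₗ[ℝ] E) {t κ : ℝ}
    (ht : 0 ≤ t) (hκt : κ < t) (hK : ∀ c, ν (K c) ≤ κ * ν c) : E →ₗ[ℝ] E :=
  ((LinearEquiv.ofBijective (t • LinearMap.id + K : E →ₗ[ℝ] E)
    (gauge_bijective hs ha hd K ht hκt hK)).symm : E →ₗ[ℝ] E)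

/-- `nearScalarInv` solves the equation. -/
theorem nearScalarInv_eq (hs : ∀ (r : ℝ) (c : E), ν (r • c) = |r| * ν c)
    (ha : ∀ a b : E, ν (a + b) ≤ ν a + ν b) (hd : ∀ c : E, ν c = 0 → c = 0) (K : E →ₗ[ℝ] E) {t κ : ℝ}
    (ht : 0 ≤ t) (hκt : κ < t) (hK : ∀ c, ν (K c) ≤ κ * ν c) (δ : E) :
    t • nearScalarInv hs ha hd K ht hκt hK δ + K (nearScalarInv hs ha hd K ht hκt hK δ) = δ := by
  have h := (LinearEquiv.ofBijective (t • LinearMap.id + K : E →ₗ[ℝ] E)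
    (gauge_bijective hs ha hd K ht hκt hK)).apply_symm_apply δ
  rw [LinearEquiv.ofBijective_apply, LinearMap.add_apply, LinearMap.smul_apply, LinearMap.id_apply] at h
  exact h

/-- `nearScalarInv` is a left inverse too. -/
theorem nearScalarInv_apply (hs : ∀ (r : ℝ) (c : E), ν (r • c) = |r| * ν c)
    (ha : ∀ a b : E, ν (a + b) ≤ ν a + ν b) (hd : ∀ c : E, ν c = 0 → c = 0) (K : E →ₗ[ℝ] E) {t κ : ℝ}
    (ht : 0 ≤ t) (hκt : κ < t) (hK : ∀ c, ν (K c) ≤ κ * ν c) (c : E) :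
    nearScalarInv hs ha hd K ht hκt hK (t • c + K c) = c := by
  have h := (LinearEquiv.ofBijective (t • LinearMap.id + K : E →ₗ[ℝ] E)
    (gauge_bijective hs ha hd K ht hκt hK)).symm_apply_apply c
  rw [LinearEquiv.ofBijective_apply, LinearMap.add_apply, LinearMap.smul_apply, LinearMap.id_apply] at h
  exact h

/-- The bound on the solution, gauge form. -/
theorem gauge_nearScalarInv_le (hs : ∀ (r : ℝ) (c : E), ν (r • c) = |r| * ν c)
    (ha : ∀ a b : E, ν (a + b) ≤ ν a + ν b) (hd : ∀ c : E, ν c = 0 → c = 0) (K : E →ₗ[ℝ] E) {t κ : ℝ}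
    (ht : 0 ≤ t) (hκt : κ < t) (hK : ∀ c, ν (K c) ≤ κ * ν c) (δ : E) :
    ν (nearScalarInv hs ha hd K ht hκt hK δ) ≤ ν δ / (t - κ) :=
  gauge_le_of_eq hs ha K ht hκt hK (nearScalarInv_eq hs ha hd K ht hκt hK δ)

/-- Congruence in `K` (the proof arguments are irrelevant): used downstream for the periodicity of the
coefficient field when `K_{z+N•e} = K_z` holds propositionally. -/
theorem nearScalarInv_congr (hs : ∀ (r : ℝ) (c : E), ν (r • c) = |r| * ν c)
    (ha : ∀ a b : E, ν (a + b) ≤ ν a + ν b) (hd : ∀ c : E, ν c = 0 → c = 0) {K K' : E →ₗ[ℝ] E} {t κ : ℝ}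
    (ht : 0 ≤ t) (hκt : κ < t) (hK : ∀ c, ν (K c) ≤ κ * ν c) (hK' : ∀ c, ν (K' c) ≤ κ * ν c)
    (hKK' : K = K') (δ : E) : nearScalarInv hs ha hd K ht hκt hK δ = nearScalarInv hs ha hd K' ht hκt hK' δ := by
  subst hKK'
  rfl

/-- Equivariance: a linear map commuting with `K` commutes with `nearScalarInv` (used downstream with
`S := X ↦ −Xᴴ` for skewness and with lattice translations for periodicity of the coefficient field). -/
theorem nearScalarInv_map_comm (hs : ∀ (r : ℝ) (c : E), ν (r • c) = |r| * ν c)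
    (ha : ∀ a b : E, ν (a + b) ≤ ν a + ν b) (hd : ∀ c : E, ν c = 0 → c = 0) (K : E →ₗ[ℝ] E) {t κ : ℝ}
    (ht : 0 ≤ t) (hκt : κ < t) (hK : ∀ c, ν (K c) ≤ κ * ν c) (S : E →ₗ[ℝ] E) (hSK : ∀ c, S (K c) = K (S c))
    (δ : E) : nearScalarInv hs ha hd K ht hκt hK (S δ) = S (nearScalarInv hs ha hd K ht hκt hK δ) := by
  apply gauge_injective hs ha hd K ht hκt hK
  simp only [LinearMap.add_apply, LinearMap.smul_apply, LinearMap.id_apply]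
  rw [nearScalarInv_eq, ← hSK, ← LinearMap.map_smul, ← map_add, nearScalarInv_eq]

end Inverse

section Norm

variable {E : Type*} [NormedAddCommGroup E] [NormedSpace ℝ E]

/-- The instance norm is absolutely homogeneous (in the `|r|` spelling). -/
theorem norm_smul_abs (r : ℝ) (c : E) : ‖r • c‖ = |r| * ‖c‖ := by rw [norm_smul, Real.norm_eq_abs]

/-- Existence, uniqueness and the bound in the instance norm. -/
theorem existsUnique_solve_norm [FiniteDimensional ℝ E] (K : E →ₗ[ℝ] E) {t κ : ℝ} (ht : 0 ≤ t) (hκt : κ < t)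
    (hK : ∀ c, ‖K c‖ ≤ κ * ‖c‖) (δ : E) : ∃! c : E, t • c + K c = δ ∧ ‖c‖ ≤ ‖δ‖ / (t - κ) :=
  gauge_existsUnique_solve norm_smul_abs norm_add_le (fun _ h => norm_eq_zero.1 h) K ht hκt hK δ

/-- The bound on `nearScalarInv` in the instance norm. -/
theorem norm_nearScalarInv_le [FiniteDimensional ℝ E] (K : E →ₗ[ℝ] E) {t κ : ℝ} (ht : 0 ≤ t) (hκt : κ < t)
    (hK : ∀ c, ‖K c‖ ≤ κ * ‖c‖) (δ : E) :
    ‖nearScalarInv norm_smul_abs norm_add_le (fun _ h => norm_eq_zero.1 h) K ht hκt hK δ‖ ≤ ‖δ‖ / (t - κ) :=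
  gauge_nearScalarInv_le norm_smul_abs norm_add_le (fun _ h => norm_eq_zero.1 h) K ht hκt hK δ

end Norm

section NHS

variable {n : Type*} [Fintype n]

/-- Homogeneity of the normalised Hilbert–Schmidt norm under real scalars. -/
theorem nhsNorm_smul (r : ℝ) (X : Matrix n n ℂ) : nhsNorm (r • X) = |r| * nhsNorm X := by
  unfold nhsNorm
  rw [AveragingDeficitHSInner.nhsNormSq_smul, Real.sqrt_mul (sq_nonneg r), Real.sqrt_sq_eq_abs]

variable [DecidableEq n]

/-- Definiteness of the normalised Hilbert–Schmidt norm. -/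
theorem eq_zero_of_nhsNorm_eq_zero {X : Matrix n n ℂ} (h : nhsNorm X = 0) : X = 0 := by
  apply NE3LandauOrbit.eq_zero_of_nhsNormSq_eq_zero
  unfold nhsNorm at h
  rwa [Real.sqrt_eq_zero (nhsNormSq_nonneg X)] at h

/-- Existence, uniqueness and the bound in `nhsNorm`. -/
theorem existsUnique_solve_nhsNorm (K : Matrix n n ℂ →ₗ[ℝ] Matrix n n ℂ) {t κ : ℝ} (ht : 0 ≤ t) (hκt : κ < t)
    (hK : ∀ c, nhsNorm (K c) ≤ κ * nhsNorm c) (δ : Matrix n n ℂ) :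
    ∃! c : Matrix n n ℂ, t • c + K c = δ ∧ nhsNorm c ≤ nhsNorm δ / (t - κ) :=
  gauge_existsUnique_solve nhsNorm_smul NE3CovariantFaceTrace.nhsNorm_add_le
    (fun _ h => eq_zero_of_nhsNorm_eq_zero h) K ht hκt hK δ

/-- DATA: the `nhsNorm`-controlled inverse of `t • id + K` on `Matrix n n ℂ`. -/
noncomputable def nhsNearScalarInv (K : Matrix n n ℂ →ₗ[ℝ] Matrix n n ℂ) {t κ : ℝ} (ht : 0 ≤ t) (hκt : κ < t)
    (hK : ∀ c, nhsNorm (K c) ≤ κ * nhsNorm c) : Matrix n n ℂ →ₗ[ℝ] Matrix n n ℂ :=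
  nearScalarInv nhsNorm_smul NE3CovariantFaceTrace.nhsNorm_add_le (fun _ h => eq_zero_of_nhsNorm_eq_zero h)
    K ht hκt hK

/-- `nhsNearScalarInv` solves the equation. -/
theorem nhsNearScalarInv_eq (K : Matrix n n ℂ →ₗ[ℝ] Matrix n n ℂ) {t κ : ℝ} (ht : 0 ≤ t) (hκt : κ < t)
    (hK : ∀ c, nhsNorm (K c) ≤ κ * nhsNorm c) (δ : Matrix n n ℂ) :
    t • nhsNearScalarInv K ht hκt hK δ + K (nhsNearScalarInv K ht hκt hK δ) = δ :=
  nearScalarInv_eq _ _ _ K ht hκt hK δ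

/-- `nhsNearScalarInv` is a left inverse too. -/
theorem nhsNearScalarInv_apply (K : Matrix n n ℂ →ₗ[ℝ] Matrix n n ℂ) {t κ : ℝ} (ht : 0 ≤ t) (hκt : κ < t)
    (hK : ∀ c, nhsNorm (K c) ≤ κ * nhsNorm c) (c : Matrix n n ℂ) :
    nhsNearScalarInv K ht hκt hK (t • c + K c) = c :=
  nearScalarInv_apply _ _ _ K ht hκt hK c

/-- Congruence of `nhsNearScalarInv` in `K`. -/
theorem nhsNearScalarInv_congr {K K' : Matrix n n ℂ →ₗ[ℝ] Matrix n n ℂ} {t κ : ℝ} (ht : 0 ≤ t) (hκt : κ < t)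
    (hK : ∀ c, nhsNorm (K c) ≤ κ * nhsNorm c) (hK' : ∀ c, nhsNorm (K' c) ≤ κ * nhsNorm c) (hKK' : K = K')
    (δ : Matrix n n ℂ) : nhsNearScalarInv K ht hκt hK δ = nhsNearScalarInv K' ht hκt hK' δ :=
  nearScalarInv_congr _ _ _ ht hκt hK hK' hKK' δ

/-- Equivariance of `nhsNearScalarInv` under a linear map commuting with `K`. -/
theorem nhsNearScalarInv_map_comm (K : Matrix n n ℂ →ₗ[ℝ] Matrix n n ℂ) {t κ : ℝ} (ht : 0 ≤ t) (hκt : κ < t)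
    (hK : ∀ c, nhsNorm (K c) ≤ κ * nhsNorm c) (S : Matrix n n ℂ →ₗ[ℝ] Matrix n n ℂ)
    (hSK : ∀ c, S (K c) = K (S c)) (δ : Matrix n n ℂ) :
    nhsNearScalarInv K ht hκt hK (S δ) = S (nhsNearScalarInv K ht hκt hK δ) :=
  nearScalarInv_map_comm _ _ _ K ht hκt hK S hSK δ

/-- The bound on `nhsNearScalarInv` in `nhsNorm`. -/
theorem nhsNorm_nhsNearScalarInv_le (K : Matrix n n ℂ →ₗ[ℝ] Matrix n n ℂ) {t κ : ℝ} (ht : 0 ≤ t) (hκt : κ < t)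
    (hK : ∀ c, nhsNorm (K c) ≤ κ * nhsNorm c) (δ : Matrix n n ℂ) :
    nhsNorm (nhsNearScalarInv K ht hκt hK δ) ≤ nhsNorm δ / (t - κ) :=
  gauge_nearScalarInv_le _ _ _ K ht hκt hK δ

/-- Squared form of the `nhsNorm` bound (the ℓ² currency of J2 and K6). -/
theorem nhsNormSq_nhsNearScalarInv_le (K : Matrix n n ℂ →ₗ[ℝ] Matrix n n ℂ) {t κ : ℝ} (ht : 0 ≤ t)
    (hκt : κ < t) (hK : ∀ c, nhsNorm (K c) ≤ κ * nhsNorm c) (δ : Matrix n n ℂ) :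
    nhsNormSq (nhsNearScalarInv K ht hκt hK δ) ≤ nhsNormSq δ / (t - κ) ^ 2 := by
  have h := nhsNorm_nhsNearScalarInv_le K ht hκt hK δ
  have h0 : 0 ≤ nhsNorm (nhsNearScalarInv K ht hκt hK δ) := Real.sqrt_nonneg _
  have h1 : nhsNormSq (nhsNearScalarInv K ht hκt hK δ) = nhsNorm (nhsNearScalarInv K ht hκt hK δ) ^ 2 := by
    unfold nhsNorm; rw [Real.sq_sqrt (nhsNormSq_nonneg _)]
  have h2 : nhsNormSq δ = nhsNorm δ ^ 2 := by unfold nhsNorm; rw [Real.sq_sqrt (nhsNormSq_nonneg _)]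
  rw [h1, h2, ← div_pow]
  exact pow_le_pow_left₀ h0 h 2

end NHS

end Summit.QuantumFields.BalabanUV.T4Continuum.NE3NearScalarSolve
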